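import Mathlib
import Summits.Ventures.FusionMHD.Models.CerfonFreidbergIterLikeAxisShape
import Summits.Ventures.FusionMHD.Models.CerfonFreidbergNstxLikeAxisShape
import Summits.Ventures.FusionMHD.Models.SolovevPCFMercierAxisShaped
import HarnessLib

/-!
# Ventures/FusionMHD — Models/CerfonFreidbergMercierAxisMikhailovskii.lean: the near-axis Mercier rows of the four analytic instances
# (PCF ITER-like and NSTX-like, CF ITER-like and NSTX-like) in MIKHAILOVSKII's (8.15) form — a THIRD printed lineage (rider; no new number)

HONEST FRAMING (LADDER-GRIDFUSION three columns; rungs F1.MER-axis PCF rows and #34 / #47 CF rows).  gridfusion-lit-3 (g6, p511583,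
`MercierNearAxis.lean` §5) typed Mikhailovskii, *Instabilities in a Confined Plasma* (1998) §8.2.1 (8.15)–(8.16) [Shafranov–Yurchenko 1968 /
Mikhailovskii 1973 lineage] and PROVED `Mikhailovskii.criterion_iff_shapedAxisCriterion`: `Criterion q e β_p τ_R` with `e = ellipticity κ`
is Freidberg's (12.89) `ShapedAxisCriterion q κ (4√(cosh η)·τ_R) (cosh η·β_p)`.  Our instance rows are already stated in Freidberg's form
(`…AxisShape.mercierNearAxis_iff_shapedAxisCriterion_U`, `SolovevPCFMercierAxisShaped.mercierNearAxis_iff_shaped`); inverting lit-3's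
normalisation maps (`β_p = β_p0 / cosh η`, `τ_R = (δ/ε)/(4√(cosh η))`, `cosh η = (κ² + 1)/(2κ) ≥ 1`) gives, for every `F ≠ 0`, the SAME
certified row as Mikhailovskii's criterion — so every near-axis Mercier threshold of the F1 rows (PCF: 0.6191 / 1.1186; CF: 0.5583 / 1.1113)
is the threshold of THREE printed criteria of two independent lineages.  MODELLED: near-axis expansion, necessary criterion; analytic
equilibria; no stability claim.  Typer/prover: gridfusion-model-5 (g5), 2026-08-27.  Citations: Mikhailovskii 1998 §8.2.1 (8.15)–(8.16)
[Mikhailovskii1998]; Freidberg 2014 §12.5.4 (12.89) [Freidberg2014]; Bateman 1978 §7.3 (7.3.2) [Bateman1978].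
-/

noncomputable section

open Literature.MathematicalPhysics.MHD Literature.MathematicalPhysics.MHD.GradShafranov
  Literature.MathematicalPhysics.MHD.Mercier.NearAxis

namespace Summit.Ventures.FusionMHD.Models

/-- The inverse normalisation: for `κ > 0` and any `(tri, β_p0)`, Freidberg's criterion at `(κ, tri, β_p0)` IS Mikhailovskii's at
`e = ellipticity κ`, `β_p = β_p0/cosh η`, `τ_R = tri/(4√(cosh η))`. -/
theorem shapedAxisCriterion_iff_mikhailovskii {κ : ℝ} (hκ : 0 < κ) (q tri βp0 : ℝ) :
    ShapedAxisCriterion q κ tri βp0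
      ↔ Mikhailovskii.Criterion q (Mikhailovskii.ellipticity κ) (βp0 / Mikhailovskii.coshEta κ)
          (tri / (4 * Real.sqrt (Mikhailovskii.coshEta κ))) := by
  have hc : 0 < Mikhailovskii.coshEta κ := lt_of_lt_of_le one_pos (Mikhailovskii.one_le_coshEta hκ)
  have hs : 0 < Real.sqrt (Mikhailovskii.coshEta κ) := Real.sqrt_pos.mpr hc
  rw [Mikhailovskii.criterion_iff_shapedAxisCriterion hκ]
  have e1 : 4 * Real.sqrt (Mikhailovskii.coshEta κ) * (tri / (4 * Real.sqrt (Mikhailovskii.coshEta κ))) = tri := by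
    field_simp
  have e2 : Mikhailovskii.coshEta κ * (βp0 / Mikhailovskii.coshEta κ) = βp0 := by
    field_simp
  rw [e1, e2]

namespace CFIterLike

/-- **CF ITER-like near-axis Mercier row in Mikhailovskii's form** (`β_p0 = 1`, `δ/ε = κ₀Δ` with `Δ` the jet-triangularity). -/
theorem mercierNearAxis_iff_mikhailovskii {F : ℝ} (hF : F ≠ 0) :
    MercierCriterion (safetyFactorOnAxis F CFIterLike.Xa (dRR CFIterLike.U CFIterLike.Xa 0) (dZZ CFIterLike.U CFIterLike.Xa 0))
        (elongationOnAxis (dRR CFIterLike.U CFIterLike.Xa 0) (dZZ CFIterLike.U CFIterLike.Xa 0)) 0 (SolovevPCF.nearAxisD CFIterLike.U CFIterLike.Xa)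
      ↔ Mikhailovskii.Criterion (safetyFactorOnAxis F CFIterLike.Xa (dRR CFIterLike.U CFIterLike.Xa 0) (dZZ CFIterLike.U CFIterLike.Xa 0))
          (Mikhailovskii.ellipticity (elongationOnAxis (dRR CFIterLike.U CFIterLike.Xa 0) (dZZ CFIterLike.U CFIterLike.Xa 0)))
          (1 / Mikhailovskii.coshEta (elongationOnAxis (dRR CFIterLike.U CFIterLike.Xa 0) (dZZ CFIterLike.U CFIterLike.Xa 0)))
          (elongationOnAxis (dRR CFIterLike.U CFIterLike.Xa 0) (dZZ CFIterLike.U CFIterLike.Xa 0)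
              * SolovevPCF.nearAxisTriangularity CFIterLike.U CFIterLike.Xa
                  (elongationOnAxis (dRR CFIterLike.U CFIterLike.Xa 0) (dZZ CFIterLike.U CFIterLike.Xa 0))
            / (4 * Real.sqrt (Mikhailovskii.coshEta (elongationOnAxis (dRR CFIterLike.U CFIterLike.Xa 0) (dZZ CFIterLike.U CFIterLike.Xa 0))))) := by
  have he : 0 < elongationOnAxis (dRR CFIterLike.U CFIterLike.Xa 0) (dZZ CFIterLike.U CFIterLike.Xa 0) := by
    linarith [CFIterLike.elongationOnAxis_bounds.1]
  rw [CFIterLike.mercierNearAxis_iff_shapedAxisCriterion_U hF, shapedAxisCriterion_iff_mikhailovskii he]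

end CFIterLike

namespace CFNstxLike

/-- **CF NSTX-like near-axis Mercier row in Mikhailovskii's form.** -/
theorem mercierNearAxis_iff_mikhailovskii {F : ℝ} (hF : F ≠ 0) :
    MercierCriterion (safetyFactorOnAxis F CFNstxLike.Xa (dRR CFNstxLike.U CFNstxLike.Xa 0) (dZZ CFNstxLike.U CFNstxLike.Xa 0))
        (elongationOnAxis (dRR CFNstxLike.U CFNstxLike.Xa 0) (dZZ CFNstxLike.U CFNstxLike.Xa 0)) 0 (SolovevPCF.nearAxisD CFNstxLike.U CFNstxLike.Xa)
      ↔ Mikhailovskii.Criterion (safetyFactorOnAxis F CFNstxLike.Xa (dRR CFNstxLike.U CFNstxLike.Xa 0) (dZZ CFNstxLike.U CFNstxLike.Xa 0))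
          (Mikhailovskii.ellipticity (elongationOnAxis (dRR CFNstxLike.U CFNstxLike.Xa 0) (dZZ CFNstxLike.U CFNstxLike.Xa 0)))
          (1 / Mikhailovskii.coshEta (elongationOnAxis (dRR CFNstxLike.U CFNstxLike.Xa 0) (dZZ CFNstxLike.U CFNstxLike.Xa 0)))
          (elongationOnAxis (dRR CFNstxLike.U CFNstxLike.Xa 0) (dZZ CFNstxLike.U CFNstxLike.Xa 0)
              * SolovevPCF.nearAxisTriangularity CFNstxLike.U CFNstxLike.Xa
                  (elongationOnAxis (dRR CFNstxLike.U CFNstxLike.Xa 0) (dZZ CFNstxLike.U CFNstxLike.Xa 0))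
            / (4 * Real.sqrt (Mikhailovskii.coshEta (elongationOnAxis (dRR CFNstxLike.U CFNstxLike.Xa 0) (dZZ CFNstxLike.U CFNstxLike.Xa 0))))) := by
  have he : 0 < elongationOnAxis (dRR CFNstxLike.U CFNstxLike.Xa 0) (dZZ CFNstxLike.U CFNstxLike.Xa 0) := by
    linarith [CFNstxLike.elongationOnAxis_bounds.1]
  rw [CFNstxLike.mercierNearAxis_iff_shapedAxisCriterion_U hF, shapedAxisCriterion_iff_mikhailovskii he]

end CFNstxLike

namespace SolovevPCF.IterLike

/-- **PCF ITER-like near-axis Mercier row in Mikhailovskii's form** (`δ/ε = 1/2`, `β_p0 = 1`). -/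
theorem mercierNearAxis_iff_mikhailovskii {F : ℝ} (hF : F ≠ 0) :
    MercierCriterion (safetyFactorOnAxis F IterLike.Ra (dRR IterLike.psi IterLike.Ra 0) (dZZ IterLike.psi IterLike.Ra 0))
        (elongationOnAxis (dRR IterLike.psi IterLike.Ra 0) (dZZ IterLike.psi IterLike.Ra 0)) 0 (nearAxisD IterLike.psi IterLike.Ra)
      ↔ Mikhailovskii.Criterion (safetyFactorOnAxis F IterLike.Ra (dRR IterLike.psi IterLike.Ra 0) (dZZ IterLike.psi IterLike.Ra 0))
          (Mikhailovskii.ellipticity (elongationOnAxis (dRR IterLike.psi IterLike.Ra 0) (dZZ IterLike.psi IterLike.Ra 0)))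
          (1 / Mikhailovskii.coshEta (elongationOnAxis (dRR IterLike.psi IterLike.Ra 0) (dZZ IterLike.psi IterLike.Ra 0)))
          ((1 / 2) / (4 * Real.sqrt (Mikhailovskii.coshEta (elongationOnAxis (dRR IterLike.psi IterLike.Ra 0) (dZZ IterLike.psi IterLike.Ra 0))))) := by
  rw [IterLike.mercierNearAxis_iff_shaped hF, shapedAxisCriterion_iff_mikhailovskii IterLike.elongationOnAxis_pos]

end SolovevPCF.IterLike

namespace SolovevPCF.NstxLike

/-- **PCF NSTX-like near-axis Mercier row in Mikhailovskii's form** (`δ/ε = 1/2`, `β_p0 = 1`). -/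
theorem mercierNearAxis_iff_mikhailovskii {F : ℝ} (hF : F ≠ 0) :
    MercierCriterion (safetyFactorOnAxis F NstxLike.Ra (dRR NstxLike.psi NstxLike.Ra 0) (dZZ NstxLike.psi NstxLike.Ra 0))
        (elongationOnAxis (dRR NstxLike.psi NstxLike.Ra 0) (dZZ NstxLike.psi NstxLike.Ra 0)) 0 (nearAxisD NstxLike.psi NstxLike.Ra)
      ↔ Mikhailovskii.Criterion (safetyFactorOnAxis F NstxLike.Ra (dRR NstxLike.psi NstxLike.Ra 0) (dZZ NstxLike.psi NstxLike.Ra 0))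
          (Mikhailovskii.ellipticity (elongationOnAxis (dRR NstxLike.psi NstxLike.Ra 0) (dZZ NstxLike.psi NstxLike.Ra 0)))
          (1 / Mikhailovskii.coshEta (elongationOnAxis (dRR NstxLike.psi NstxLike.Ra 0) (dZZ NstxLike.psi NstxLike.Ra 0)))
          ((1 / 2) / (4 * Real.sqrt (Mikhailovskii.coshEta (elongationOnAxis (dRR NstxLike.psi NstxLike.Ra 0) (dZZ NstxLike.psi NstxLike.Ra 0))))) := by
  rw [NstxLike.mercierNearAxis_iff_shaped hF, shapedAxisCriterion_iff_mikhailovskii NstxLike.elongationOnAxis_pos]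

end SolovevPCF.NstxLike

end Summit.Ventures.FusionMHD.Models
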